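import Mathlib
import Literature.Barriers.Parity.EuclideanProofs
import HarnessLib

/-!
# Schur's existence theorem for Euclidean polynomials, proved

Topic `Literature/Barriers/Parity`, sibling of `EuclideanProofs.lean` (the catalogue entry for
Murty's impossibility theorem). This file DISCHARGES the named fact
`Literature.Barriers.Parity.Schur1912_euclideanPolynomial` of that file:

* `Schur1912_euclideanPolynomial_holds` — if `m ≥ 1` and `a² ≡ 1 (mod m)`, there is an
  `E`-polynomial (`IsEuclideanPolynomial f a m`) for the progression `a mod m`.

## The source and the architecture followed

I. Schur, *Über die Existenz unendlich vieler Primzahlen in einigen speziellen arithmetischen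
Progressionen*, Sitzungsber. Berlin. Math. Ges. 11 (1912) 40–50 [cite: Schur1912], as reviewed
in full by M. R. Murty, N. Thain, *Prime numbers in certain arithmetic progressions*, Funct.
Approx. 35 (2006) 249–259, §2, Theorems 4–6 (pp. 252–254; verified on the page, Project Euclid
copy): "Theorem 4. (Schur) Let `H` be a subgroup of `(ℤ/kℤ)*`. Then there is an irreducible
polynomial `f` so that all of the prime divisors of `f`, with a finite number of exceptions,
belong to the residue classes of `H`" — with `η = h(ζ)` generating the fixed field of `H`,
`f(x) = ∏ᵢ (x − h(ζ^{mᵢ}))`, the exceptional primes being `p ∣ k` and `p ∣ D(f)`, and the key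
congruence `h(ζ^{mᵢ}) ≡ a ≡ aᵖ ≡ h(ζ^{mᵢ})ᵖ ≡ h(ζ^{p mᵢ}) (mod 𝔭)`; "Theorem 5. (Schur) If `f` is
as in Theorem 4, then any prime belonging to any residue class of `H` divides `f`" — `σ_p` fixes
`η`, so `ηᵖ ≡ η (mod 𝔭)`, "there are at most `p` solutions to `xᵖ − x` in this field", hence
`η ≡ a (mod 𝔭)` for a rational integer `a` and `p ∣ f(a)`; Theorem 6: for `H = {1, l}`,
`l² ≡ 1 (mod k)`, take `h(ζ) = (u − ζ)(u − ζˡ)` for a rational integer `u` such that the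
`h(ζ^{mᵢ})` are distinct, so that `f(x)² = ∏_{(a,k)=1} (x − (u − ζᵃ)(u − ζ^{la}))`
[cite: MurtyThain2006, §2 Theorems 4–6 (pp. 252–254)]. (Conrad, Theorem 1, and Pollack, §2.2,
state the result and refer to Schur / Murty–Thain [cite: ConradEuclideanDirichlet, Theorem 1]
[cite: Pollack2010MurtyH, §2.2].)

What is formalised here is exactly this construction with the FIXED choice `u = −1`, i.e.
`h(ζ) = (1 + ζ)(1 + ζᵃ)`, for which the distinctness of the `h(ζᵏ)` over the cosets of
`H = {1, a}` holds for every `m` (proof: complex conjugation inverts roots of unity, so equal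
values force equal products `ζᵏ⁽¹⁺ᵃ⁾` and then equal sums, i.e. the same unordered pair
`{ζᵏ, ζᵃᵏ}`), and with the polynomial
`f(T) = ∏_{k ∈ (ℤ/mℤ)ˣ} (T − (1 + ζᵏ)(1 + ζᵃᵏ)) ∈ ℤ[T]` (Murty–Thain's `f²`; squaring is
harmless for prime divisors). To stay elementary (no number fields, no prime ideals `𝔭`):

* integrality of the coefficients of `f` and of the "discriminant"
  `D = ∏_{k' ∉ k H} (h(ζᵏ) − h(ζᵏ'))` is obtained by a descent lemma — an integer polynomial
  `Q(X)` whose value at `ζᶜ` is the same for all units `c` is congruent modulo `Φ_m` to the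
  constant `(Q mod Φ_m)(0)`, because the remainder minus that value has `φ(m)` roots and degree
  `< φ(m)` (`Schur1912.modByMonic_eq_C`); consequently `Q` takes that same integer value at every
  primitive `m`-th root of unity in EVERY domain (`Schur1912.aeval_eq_dconst`) — this replaces
  "reduction mod `𝔭`";
* the finite field is `CyclotomicField m (ZMod p)` with its primitive root `zeta`, the Frobenius
  congruence is `((1 + x)(1 + y))ᵖ = (1 + xᵖ)(1 + yᵖ)` (`Schur1912.eta_pow_char`), and "at most `p`
  solutions to `xᵖ − x`" is `Schur1912.exists_algebraMap_eq_of_pow_eq`;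
* clause (2) of `IsEuclideanPolynomial` (infinitely many prime divisors `≡ a (mod m)`) is
  Theorem 5 (`Schur1912.exists_dvd_eval_schurPoly`: EVERY prime `p ≡ a (mod m)` is a prime
  divisor of `f`) combined with Dirichlet's theorem from Mathlib
  (`Nat.infinite_setOf_prime_and_eq_mod`), as for the file's `isEuclideanPolynomial_X_neg_one_four`;
  Murty–Thain's Euclid-style Theorem 6 (the argument with `f(c)`, `c ≡ b (mod p²)`,
  `c ≡ 0 (mod kQ)`) is not needed for the existence statement and is not transcribed;
* clause (3) (all prime divisors outside `p ∣ m·D` are `≡ 1` or `≡ a`) is Theorem 4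
  (`Schur1912.cast_eq_one_or_eq_of_dvd_eval`).

No new definition of mathematical content beyond the explicit polynomial (`Schur1912.schurPoly`)
and its bookkeeping; no named fact is introduced.
-/

open Polynomial

namespace Literature.Barriers.Parity

namespace Schur1912

variable {m : ℕ}

/-! ### Schur's generator `h(ζᵏ) = (1 + ζᵏ)(1 + ζᵃᵏ)` and its behaviour under `ζ ↦ ζᶜ` -/

/-- Schur's generator for the coset `k H`, `H = {1, α}`: `η_k(z) = (1 + z^k)(1 + z^{α k})`
(Murty–Thain's `h(ζ^{k}) = (u − ζᵏ)(u − ζ^{lk})` with `u = −1`), in any commutative ring, the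
exponents being the representatives in `[0, m)`. [cite: MurtyThain2006, §2 Theorem 6 (p. 253)] -/
def eta (α k : (ZMod m)ˣ) {R : Type*} [CommRing R] (z : R) : R :=
  (1 + z ^ ((k : (ZMod m)ˣ) : ZMod m).val) * (1 + z ^ ((α * k : (ZMod m)ˣ) : ZMod m).val)

/-- Exponent bookkeeping: `(zᵏ)ⁿ = z^{c k}` when `zᵐ = 1` and `n ≡ c (mod m)`. [folklore] -/
theorem pow_val_pow {R : Type*} [CommRing R] {z : R} (hz : z ^ m = 1) {n : ℕ} {c : (ZMod m)ˣ}
    (hc : ((n : ℕ) : ZMod m) = (c : ZMod m)) (k : (ZMod m)ˣ) :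
    (z ^ ((k : (ZMod m)ˣ) : ZMod m).val) ^ n = z ^ ((c * k : (ZMod m)ˣ) : ZMod m).val := by
  have key : ∀ t : ℕ, z ^ t = z ^ (t % m) := fun t => by
    conv_lhs => rw [← Nat.div_add_mod t m, pow_add, pow_mul, hz, one_pow, one_mul]
  rw [← pow_mul, key, Units.val_mul, ZMod.val_mul, ← hc, ZMod.val_natCast]
  congr 1
  calc ((k : (ZMod m)ˣ) : ZMod m).val * n % m
        = n * ((k : (ZMod m)ˣ) : ZMod m).val % m := by rw [mul_comm]
    _ = (n % m) * (((k : (ZMod m)ˣ) : ZMod m).val % m) % m := Nat.mul_mod _ _ _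
    _ = (n % m % m) * (((k : (ZMod m)ˣ) : ZMod m).val % m) % m := by rw [Nat.mod_mod]
    _ = (n % m) * ((k : (ZMod m)ˣ) : ZMod m).val % m := (Nat.mul_mod _ _ _).symm

/-- `η_k(zᶜ) = η_{ck}(z)` for `zᵐ = 1`: the substitution `ζ ↦ ζᶜ` permutes the generators.
[cite: MurtyThain2006, §2 Theorem 4 (proof)] -/
theorem eta_comp_pow [NeZero m] {R : Type*} [CommRing R] {z : R} (hz : z ^ m = 1)
    (α c k : (ZMod m)ˣ) :
    eta α k (z ^ ((c : (ZMod m)ˣ) : ZMod m).val) = eta α (c * k) z := by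
  have hc : ((((c : (ZMod m)ˣ) : ZMod m).val : ℕ) : ZMod m) = (c : ZMod m) :=
    ZMod.natCast_zmod_val _
  unfold eta
  rw [pow_right_comm z _ ((k : (ZMod m)ˣ) : ZMod m).val,
    pow_right_comm z _ ((α * k : (ZMod m)ˣ) : ZMod m).val, pow_val_pow hz hc k,
    pow_val_pow hz hc (α * k), mul_left_comm c α k]

/-- The Frobenius congruence `h(x)ᵖ ≡ h(xᵖ)`: in characteristic `p`, `η_k(z)ᵖ = η_{πk}(z)` where
`π = p mod m`. [cite: MurtyThain2006, §2 Theorem 4 (proof)] -/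
theorem eta_pow_char {R : Type*} [CommRing R] {p : ℕ} [Fact p.Prime] [CharP R p] {z : R}
    (hz : z ^ m = 1) {π : (ZMod m)ˣ} (hπ : ((p : ℕ) : ZMod m) = (π : ZMod m))
    (α k : (ZMod m)ˣ) : eta α k z ^ p = eta α (π * k) z := by
  unfold eta
  rw [mul_pow, add_pow_char, add_pow_char, one_pow, pow_val_pow hz hπ k, pow_val_pow hz hπ (α * k),
    mul_left_comm π α k]

/-- `η_{αk} = η_k` when `α² = 1` (the generator only depends on the coset of `H = {1, α}`).
[cite: MurtyThain2006, §2 Theorem 6] -/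
theorem eta_mul_self {R : Type*} [CommRing R] (z : R) {α : (ZMod m)ˣ} (hα : α * α = 1)
    (k : (ZMod m)ˣ) : eta α (α * k) z = eta α k z := by
  unfold eta
  rw [← mul_assoc, hα, one_mul, mul_comm]

/-! ### Descent: an integer polynomial constant on primitive `m`-th roots of unity -/

/-- The integer `(Q mod Φ_m)(0)`. [folklore] -/
noncomputable def dconst (m : ℕ) (Q : ℤ[X]) : ℤ := (Q %ₘ cyclotomic m ℤ).coeff 0

/-- At a primitive `m`-th root of unity, `Q` and `Q mod Φ_m` take the same value. [folklore] -/
theorem aeval_eq_aeval_modByMonic {R : Type*} [CommRing R] [IsDomain R] {z : R}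
    (hz : IsPrimitiveRoot z m) (hm : 0 < m) (Q : ℤ[X]) :
    aeval z Q = aeval z (Q %ₘ cyclotomic m ℤ) := by
  conv_lhs => rw [← modByMonic_add_div Q (cyclotomic m ℤ)]
  have h0 : aeval z (cyclotomic m ℤ) = 0 := by
    rw [aeval_def, ← eval_map, map_cyclotomic]
    exact hz.isRoot_cyclotomic hm
  rw [map_add, map_mul, h0, zero_mul, add_zero]

/-- The primitive `m`-th root of unity `e^{2πi/m} ∈ ℂ`. [folklore] -/
noncomputable def zetaC (m : ℕ) : ℂ := Complex.exp (2 * Real.pi * Complex.I / m)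

/-- `zetaC m` is a primitive `m`-th root of unity (Mathlib). [folklore] -/
theorem isPrimitiveRoot_zetaC [NeZero m] : IsPrimitiveRoot (zetaC m) m :=
  Complex.isPrimitiveRoot_exp m (NeZero.ne m)

/-- **Descent lemma.** If `Q ∈ ℤ[X]` takes the same value at `ζᶜ` for all units `c`
(`ζ = e^{2πi/m}`), then `Q mod Φ_m` is the constant `dconst m Q`: the remainder minus `Q(ζ)` has
the `φ(m)` roots `ζᶜ` and degree `< φ(m)`. [folklore] -/
theorem modByMonic_eq_C [NeZero m] (Q : ℤ[X])
    (hQ : ∀ c : (ZMod m)ˣ, aeval (zetaC m ^ ((c : (ZMod m)ˣ) : ZMod m).val) Q = aeval (zetaC m) Q) :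
    Q %ₘ cyclotomic m ℤ = C (dconst m Q) := by
  set r := Q %ₘ cyclotomic m ℤ with hr
  have hζ : IsPrimitiveRoot (zetaC m) m := isPrimitiveRoot_zetaC
  have hm : 0 < m := NeZero.pos m
  set g : ℂ[X] := r.map (algebraMap ℤ ℂ) - C (aeval (zetaC m) Q) with hg
  have hg0 : g = 0 := by
    refine eq_zero_of_natDegree_lt_card_of_eval_eq_zero g
      (f := fun c : (ZMod m)ˣ => zetaC m ^ ((c : (ZMod m)ˣ) : ZMod m).val) ?_ ?_ ?_
    · intro c₁ c₂ h
      have h' := hζ.pow_inj (ZMod.val_lt _) (ZMod.val_lt _) h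
      exact Units.ext (ZMod.val_injective m h')
    · intro c
      rw [hg, eval_sub, eval_C, eval_map_algebraMap,
        ← aeval_eq_aeval_modByMonic (hζ.pow_of_coprime _ (ZMod.val_coe_unit_coprime c)) hm Q, hQ c,
        sub_self]
    · have hne : cyclotomic m ℤ ≠ 1 := by
        intro h1
        have h2 := congrArg natDegree h1
        rw [natDegree_cyclotomic, natDegree_one] at h2
        exact (Nat.totient_pos.mpr hm).ne' h2
      have hlt : r.natDegree < Fintype.card (ZMod m)ˣ := by
        rw [ZMod.card_units_eq_totient, ← natDegree_cyclotomic m ℤ]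
        exact natDegree_modByMonic_lt Q (cyclotomic.monic m ℤ) hne
      calc g.natDegree ≤ max (r.map (algebraMap ℤ ℂ)).natDegree (C (aeval (zetaC m) Q)).natDegree :=
            natDegree_sub_le _ _
        _ ≤ max r.natDegree 0 := max_le_max natDegree_map_le (natDegree_C _).le
        _ = r.natDegree := by simp
        _ < Fintype.card (ZMod m)ˣ := hlt
  have hmap : r.map (algebraMap ℤ ℂ) = C (aeval (zetaC m) Q) := sub_eq_zero.mp hg0
  ext n
  rcases n with _ | n
  · rw [coeff_C_zero, hr]
    rfl
  · have h := congrArg (fun q : ℂ[X] => q.coeff (n + 1)) hmap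
    simp only [coeff_map, coeff_C, Nat.succ_ne_zero, if_false, eq_intCast, Int.cast_eq_zero] at h
    rw [h, coeff_C, if_neg (Nat.succ_ne_zero n)]

/-- **Descent, evaluated anywhere.** Under the hypothesis of `modByMonic_eq_C`, `Q` takes the
integer value `dconst m Q` at every primitive `m`-th root of unity of every domain (characteristic
`0` or `p`): the substitute for "reduction modulo a prime ideal `𝔭 ∣ p`". [folklore] -/
theorem aeval_eq_dconst [NeZero m] (Q : ℤ[X])
    (hQ : ∀ c : (ZMod m)ˣ, aeval (zetaC m ^ ((c : (ZMod m)ˣ) : ZMod m).val) Q = aeval (zetaC m) Q)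
    {R : Type*} [CommRing R] [IsDomain R] {z : R} (hz : IsPrimitiveRoot z m) :
    aeval z Q = (dconst m Q : R) := by
  rw [aeval_eq_aeval_modByMonic hz (NeZero.pos m), modByMonic_eq_C Q hQ, aeval_C, eq_intCast]

/-! ### The generic Schur polynomial and its discriminant-like integer -/

/-- The generator as an integer polynomial in the root-of-unity variable:
`(1 + Xᵏ)(1 + X^{αk})`. [cite: MurtyThain2006, §2 Theorem 6] -/
noncomputable def etaGen (α k : (ZMod m)ˣ) : ℤ[X] :=
  (1 + X ^ ((k : (ZMod m)ˣ) : ZMod m).val) * (1 + X ^ ((α * k : (ZMod m)ˣ) : ZMod m).val)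

/-- Evaluating the generic generator. [folklore] -/
@[simp] theorem aeval_etaGen {R : Type*} [CommRing R] (z : R) (α k : (ZMod m)ˣ) :
    aeval z (etaGen α k) = eta α k z := by
  simp [etaGen, eta]

section Generic

variable [NeZero m]

/-- The generic Schur polynomial `∏_{k ∈ (ℤ/mℤ)ˣ} (T − (1 + Xᵏ)(1 + X^{αk})) ∈ ℤ[X][T]`
(Murty–Thain's displayed `f(x)² = ∏_{(a,k)=1} (x − (u − ζᵃ)(u − ζ^{la}))` with `u = −1`, before
specialising `X = ζ`; for `α = 1` it is their `f` itself). [cite: MurtyThain2006, §2 Theorem 6 (the displayed product)] -/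
noncomputable def schurGen (α : (ZMod m)ˣ) : Polynomial ℤ[X] :=
  ∏ k : (ZMod m)ˣ, (Polynomial.X - Polynomial.C (etaGen α k))

/-- Specialising the root-of-unity variable. [folklore] -/
theorem map_schurGen {R : Type*} [CommRing R] (z : R) (α : (ZMod m)ˣ) :
    (schurGen α).map (aeval z : ℤ[X] →ₐ[ℤ] R).toRingHom =
      ∏ k : (ZMod m)ˣ, (X - C (eta α k z)) := by
  rw [schurGen, Polynomial.map_prod]
  refine Finset.prod_congr rfl fun k _ => ?_
  rw [Polynomial.map_sub, map_X, map_C]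
  simp

/-- The degree of the generic Schur polynomial is at most `φ(m)`. [folklore] -/
theorem natDegree_schurGen_le (α : (ZMod m)ˣ) :
    (schurGen α).natDegree ≤ Fintype.card (ZMod m)ˣ := by
  rw [schurGen]
  refine (natDegree_prod_le _ _).trans ?_
  simp

/-- The generic "discriminant": the product of `η_{k₁} − η_{k₂}` over the ordered pairs of
units in different cosets of `H = {1, α}` (a power of Murty–Thain's discriminant `D(f)` up to
sign; only `D ≠ 0` and "`p ∤ D` ⇒ the `η` of different cosets stay distinct mod `p`" are used).
[cite: MurtyThain2006, §2 Theorem 4 (proof, "p ∤ D(f)")] -/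
noncomputable def discGen (α : (ZMod m)ˣ) : ℤ[X] :=
  ∏ q : (ZMod m)ˣ × (ZMod m)ˣ,
    if q.2 ≠ q.1 ∧ q.2 ≠ α * q.1 then etaGen α q.1 - etaGen α q.2 else 1

/-- Evaluating the generic discriminant. [folklore] -/
theorem aeval_discGen {R : Type*} [CommRing R] (z : R) (α : (ZMod m)ˣ) :
    aeval z (discGen α) = ∏ q : (ZMod m)ˣ × (ZMod m)ˣ,
      (if q.2 ≠ q.1 ∧ q.2 ≠ α * q.1 then eta α q.1 z - eta α q.2 z else 1) := by
  rw [discGen, map_prod]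
  refine Finset.prod_congr rfl fun q _ => ?_
  split_ifs <;> simp

/-- Invariance of the generic Schur polynomial under `z ↦ zᶜ` (reindex the product by `k ↦ ck`).
[cite: MurtyThain2006, §2 Theorem 4 (proof)] -/
theorem map_schurGen_pow {R : Type*} [CommRing R] {z : R} (hz : z ^ m = 1) (α c : (ZMod m)ˣ) :
    (schurGen α).map (aeval (z ^ ((c : (ZMod m)ˣ) : ZMod m).val) : ℤ[X] →ₐ[ℤ] R).toRingHom =
      (schurGen α).map (aeval z : ℤ[X] →ₐ[ℤ] R).toRingHom := by
  rw [map_schurGen, map_schurGen]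
  simp_rw [eta_comp_pow hz α c]
  exact Fintype.prod_equiv (Equiv.mulLeft c) _ _ fun k => rfl

/-- Invariance of the generic discriminant under `z ↦ zᶜ` (reindex by `(k₁, k₂) ↦ (ck₁, ck₂)`).
[cite: MurtyThain2006, §2 Theorem 4 (proof)] -/
theorem aeval_discGen_pow {R : Type*} [CommRing R] {z : R} (hz : z ^ m = 1) (α c : (ZMod m)ˣ) :
    aeval (z ^ ((c : (ZMod m)ˣ) : ZMod m).val) (discGen α) = aeval z (discGen α) := by
  rw [aeval_discGen, aeval_discGen]
  simp_rw [eta_comp_pow hz α c]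
  refine Fintype.prod_equiv (Equiv.prodCongr (Equiv.mulLeft c) (Equiv.mulLeft c)) _ _ fun q => ?_
  have h1 : (c * q.2 ≠ c * q.1) ↔ (q.2 ≠ q.1) := by rw [Ne, mul_right_inj]
  have h2 : (c * q.2 ≠ α * (c * q.1)) ↔ (q.2 ≠ α * q.1) := by
    rw [mul_left_comm α c q.1, Ne, mul_right_inj]
  simp only [Equiv.prodCongr_apply, Prod.map_fst, Prod.map_snd, Equiv.coe_mulLeft, h1, h2]

/-- **Distinctness of the generators over the cosets (characteristic `0`).** For `ζ = e^{2πi/m}`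
and units `k₂ ∉ {k₁, αk₁}`, `(1 + ζ^{k₁})(1 + ζ^{αk₁}) ≠ (1 + ζ^{k₂})(1 + ζ^{αk₂})`: complex
conjugation inverts roots of unity, so equality forces equal products and then equal sums of the
pairs `{ζ^{k}, ζ^{αk}}`, i.e. the same pair. (Murty–Thain choose the integer `u` in
`(u − ζ)(u − ζˡ)` to achieve this; `u = −1` always works.) [cite: MurtyThain2006, §2 Theorems 4 and 6] -/
theorem eta_ne_eta (α : (ZMod m)ˣ) {k₁ k₂ : (ZMod m)ˣ} (h1 : k₂ ≠ k₁) (h2 : k₂ ≠ α * k₁) :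
    eta α k₁ (zetaC m) ≠ eta α k₂ (zetaC m) := by
  intro heq
  have hζ : IsPrimitiveRoot (zetaC m) m := isPrimitiveRoot_zetaC
  have hroot : ∀ t : ℕ, (zetaC m ^ t) ^ m = 1 := fun t => by
    rw [← pow_mul, mul_comm, pow_mul, hζ.pow_eq_one, one_pow]
  have hconj : ∀ t : ℕ, starRingEnd ℂ (zetaC m ^ t) = (zetaC m ^ t)⁻¹ := fun t =>
    (Complex.inv_eq_conj (Complex.norm_eq_one_of_pow_eq_one (hroot t) (NeZero.ne m))).symm
  have hne : ∀ t : ℕ, zetaC m ^ t ≠ 0 := fun t => pow_ne_zero _ (hζ.ne_zero (NeZero.ne m))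
  unfold eta at heq
  set x := zetaC m ^ ((k₁ : (ZMod m)ˣ) : ZMod m).val with hx
  set y := zetaC m ^ ((α * k₁ : (ZMod m)ˣ) : ZMod m).val with hy
  set x' := zetaC m ^ ((k₂ : (ZMod m)ˣ) : ZMod m).val with hx'
  set y' := zetaC m ^ ((α * k₂ : (ZMod m)ˣ) : ZMod m).val with hy'
  by_cases hP : (1 + x) * (1 + y) = 0
  · -- then `−1` is a primitive `m`-th root of unity, `m ∣ 2`, and the unit group is trivial
    have hm2 : m ∣ 2 := by
      rcases mul_eq_zero.mp hP with h | h
      · have hx1 : x = -1 := (neg_eq_of_add_eq_zero_right h).symm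
        have hx2 : x ^ 2 = 1 := by rw [hx1]; norm_num
        exact (hζ.pow_of_coprime _ (ZMod.val_coe_unit_coprime k₁)).dvd_of_pow_eq_one 2 hx2
      · have hy1 : y = -1 := (neg_eq_of_add_eq_zero_right h).symm
        have hy2 : y ^ 2 = 1 := by rw [hy1]; norm_num
        exact (hζ.pow_of_coprime _ (ZMod.val_coe_unit_coprime (α * k₁))).dvd_of_pow_eq_one 2 hy2
    have htot : ∀ n : ℕ, 0 < n → n ∣ 2 → Nat.totient n ≤ 1 := by
      intro n hn hd
      have hle : n ≤ 2 := Nat.le_of_dvd two_pos hd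
      interval_cases n <;> decide
    have hcard : Fintype.card (ZMod m)ˣ ≤ 1 := by
      rw [ZMod.card_units_eq_totient]
      exact htot m (NeZero.pos m) hm2
    haveI : Subsingleton (ZMod m)ˣ := Fintype.card_le_one_iff_subsingleton.mp hcard
    exact h1 (Subsingleton.elim _ _)
  · have hconj_eq := congrArg (starRingEnd ℂ) heq
    simp only [map_mul, map_add, map_one, hx, hy, hx', hy', hconj] at hconj_eq
    rw [← hx, ← hy, ← hx', ← hy'] at hconj_eq
    -- clear denominators by hand: `w (1 + w⁻¹) = w + 1`
    have hclear : ∀ w : ℂ, w ≠ 0 → w * (1 + w⁻¹) = 1 + w := fun w hw => by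
      rw [mul_add, mul_one, mul_inv_cancel₀ hw, add_comm]
    have e1 : (1 + x⁻¹) * (1 + y⁻¹) * (x * y) = (1 + x) * (1 + y) := by
      calc (1 + x⁻¹) * (1 + y⁻¹) * (x * y) = (x * (1 + x⁻¹)) * (y * (1 + y⁻¹)) := by ring
        _ = (1 + x) * (1 + y) := by rw [hclear x (hne _), hclear y (hne _)]
    have e2 : (1 + x'⁻¹) * (1 + y'⁻¹) * (x' * y') = (1 + x') * (1 + y') := by
      calc (1 + x'⁻¹) * (1 + y'⁻¹) * (x' * y') = (x' * (1 + x'⁻¹)) * (y' * (1 + y'⁻¹)) := by ring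
        _ = (1 + x') * (1 + y') := by rw [hclear x' (hne _), hclear y' (hne _)]
    have hxy : x * y = x' * y' := by
      have h3 : (1 + x) * (1 + y) * (x' * y') = (1 + x) * (1 + y) * (x * y) := by
        calc (1 + x) * (1 + y) * (x' * y')
            = (1 + x⁻¹) * (1 + y⁻¹) * (x * y) * (x' * y') := by rw [e1]
          _ = (1 + x'⁻¹) * (1 + y'⁻¹) * (x' * y') * (x * y) := by rw [hconj_eq]; ring
          _ = (1 + x') * (1 + y') * (x * y) := by rw [e2]
          _ = (1 + x) * (1 + y) * (x * y) := by rw [← heq]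
      exact (mul_left_cancel₀ hP h3).symm
    have hsum : x + y = x' + y' := by linear_combination heq - hxy
    have hquad : (x' - x) * (x' - y) = 0 := by linear_combination (-x') * hsum + hxy
    rcases mul_eq_zero.mp hquad with h | h
    · have h' := hζ.pow_inj (ZMod.val_lt _) (ZMod.val_lt _) (sub_eq_zero.mp h)
      exact h1 (Units.ext (ZMod.val_injective m h'))
    · have h' := hζ.pow_inj (ZMod.val_lt _) (ZMod.val_lt _) (sub_eq_zero.mp h)
      exact h2 (Units.ext (ZMod.val_injective m h'))

/-- The integer `D ≠ 0` (its value at `ζ = e^{2πi/m}` is a product of non-zero differences).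
[cite: MurtyThain2006, §2 Theorem 4 (proof)] -/
theorem dconst_discGen_ne_zero (α : (ZMod m)ˣ) : dconst m (discGen α) ≠ 0 := by
  intro h0
  have hζ : IsPrimitiveRoot (zetaC m) m := isPrimitiveRoot_zetaC
  have hD := aeval_eq_dconst (discGen α) (fun c => aeval_discGen_pow hζ.pow_eq_one α c) hζ
  rw [h0, Int.cast_zero, aeval_discGen] at hD
  obtain ⟨q, -, hq⟩ := Finset.prod_eq_zero_iff.mp hD
  split_ifs at hq with hc
  · exact eta_ne_eta α hc.1 hc.2 (sub_eq_zero.mp hq)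
  · exact one_ne_zero hq

/-! ### Schur's polynomial `f ∈ ℤ[T]` -/

/-- **Schur's polynomial for `H = {1, α}`**: the integer polynomial whose `i`-th coefficient is
the descended `i`-th coefficient of the generic Schur polynomial; by `map_schurPoly` it is
`∏_{k ∈ (ℤ/mℤ)ˣ} (T − (1 + zᵏ)(1 + z^{αk}))` at every primitive `m`-th root of unity `z`.
[cite: MurtyThain2006, §2 Theorem 6 (the displayed product, u = −1)] -/
noncomputable def schurPoly (m : ℕ) [NeZero m] (α : (ZMod m)ˣ) : ℤ[X] :=
  ∑ i ∈ Finset.range (Fintype.card (ZMod m)ˣ + 1), C (dconst m ((schurGen α).coeff i)) * X ^ i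

/-- The coefficients of Schur's polynomial. [folklore] -/
theorem coeff_schurPoly (α : (ZMod m)ˣ) (n : ℕ) :
    (schurPoly m α).coeff n = dconst m ((schurGen α).coeff n) := by
  simp only [schurPoly, finsetSum_coeff, coeff_C_mul_X_pow]
  rw [Finset.sum_ite_eq]
  split_ifs with h
  · rfl
  · rw [Finset.mem_range, not_lt] at h
    have hlt : (schurGen α).natDegree < n :=
      lt_of_le_of_lt (natDegree_schurGen_le α) (Nat.lt_of_succ_le h)
    rw [coeff_eq_zero_of_natDegree_lt hlt]
    simp [dconst]

/-- **Schur's polynomial at a primitive root of unity of any domain**: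
`f = ∏_{k} (T − (1 + zᵏ)(1 + z^{αk}))` over `R`, for `z ∈ R` a primitive `m`-th root of unity —
in `ℂ` this is the definition of `f`, in characteristic `p` it is its reduction.
[cite: MurtyThain2006, §2 Theorems 4–6] -/
theorem map_schurPoly {R : Type*} [CommRing R] [IsDomain R] {z : R} (hz : IsPrimitiveRoot z m)
    (α : (ZMod m)ˣ) :
    (schurPoly m α).map (Int.castRingHom R) = ∏ k : (ZMod m)ˣ, (X - C (eta α k z)) := by
  have hζ : IsPrimitiveRoot (zetaC m) m := isPrimitiveRoot_zetaC
  rw [← map_schurGen z α]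
  ext n
  rw [coeff_map, coeff_schurPoly, coeff_map, eq_intCast]
  refine (aeval_eq_dconst ((schurGen α).coeff n) (fun c => ?_) hz).symm
  have h := congrArg (fun q => Polynomial.coeff q n) (map_schurGen_pow hζ.pow_eq_one α c)
  simpa only [coeff_map, AlgHom.toRingHom_eq_coe, RingHom.coe_coe] using h

/-- Schur's polynomial has degree `φ(m)`. [cite: MurtyThain2006, §2 Theorem 6] -/
theorem natDegree_schurPoly (α : (ZMod m)ˣ) :
    (schurPoly m α).natDegree = Fintype.card (ZMod m)ˣ := by
  have hζ : IsPrimitiveRoot (zetaC m) m := isPrimitiveRoot_zetaC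
  rw [← natDegree_map_eq_of_injective (Int.castRingHom ℂ).injective_int (schurPoly m α),
    map_schurPoly hζ, natDegree_prod _ _ fun k _ => X_sub_C_ne_zero _]
  simp

end Generic

/-! ### Arithmetic modulo `p`: Frobenius-fixed elements, Theorems 5 and 4 -/

/-- "There are at most `p` solutions to `xᵖ − x` in this field": an element of a field of
characteristic `p` fixed by Frobenius lies in the prime field.
[cite: MurtyThain2006, §2 Theorem 5 (proof)] -/
theorem exists_algebraMap_eq_of_pow_eq {p : ℕ} [Fact p.Prime] {F : Type*} [Field F]
    [Algebra (ZMod p) F] {x : F} (hx : x ^ p = x) :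
    ∃ c : ZMod p, algebraMap (ZMod p) F c = x := by
  by_contra h
  push Not at h
  have hp1 : 1 < p := (Fact.out : p.Prime).one_lt
  let ι : Option (ZMod p) → F := fun o => o.elim x (algebraMap (ZMod p) F)
  have hinj : Function.Injective ι := by
    rintro (_ | c₁) (_ | c₂) ho
    · rfl
    · exact absurd ho.symm (h c₂)
    · exact absurd ho (h c₁)
    · exact congrArg some ((algebraMap (ZMod p) F).injective ho)
  have h0 := eq_zero_of_natDegree_lt_card_of_eval_eq_zero (X ^ p - X : F[X]) hinj ?_ ?_
  · exact FiniteField.X_pow_card_sub_X_ne_zero F hp1 h0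
  · rintro (_ | c)
    · simp [ι, hx]
    · simp [ι, ← map_pow, ZMod.pow_card]
  · rw [FiniteField.X_pow_card_sub_X_natDegree_eq F hp1, Fintype.card_option, ZMod.card]
    exact Nat.lt_succ_self p

/-- **Murty–Thain's Theorem 5 (Schur) for `H = {1, α}`**: every prime `p` with `p ≡ α (mod m)`
is a prime divisor of Schur's polynomial — Frobenius swaps `zᵏ` and `z^{αk}`, so it fixes
`η₁ = (1 + z)(1 + zᵅ)`, which therefore is the class of an integer `n`, and `p ∣ f(n)`.
[cite: MurtyThain2006, §2 Theorem 5] -/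
theorem exists_dvd_eval_schurPoly [NeZero m] {p : ℕ} (hp : p.Prime) (hcop : p.Coprime m)
    {α : (ZMod m)ˣ} (hαα : α * α = 1) (hπ : ((p : ℕ) : ZMod m) = (α : ZMod m)) :
    ∃ n : ℤ, (p : ℤ) ∣ (schurPoly m α).eval n := by
  haveI := Fact.mk hp
  haveI : NeZero ((m : ℕ) : ZMod p) := ⟨by
    rw [Ne, ZMod.natCast_eq_zero_iff]
    exact (Nat.Prime.coprime_iff_not_dvd hp).mp hcop⟩
  let F := CyclotomicField m (ZMod p)
  have hz : IsPrimitiveRoot (IsCyclotomicExtension.zeta m (ZMod p) F) m :=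
    IsCyclotomicExtension.zeta_spec m (ZMod p) F
  set z := IsCyclotomicExtension.zeta m (ZMod p) F with hzdef
  haveI : CharP F p := charP_of_injective_algebraMap (algebraMap (ZMod p) F).injective p
  have hfix : eta α 1 z ^ p = eta α 1 z := by
    rw [eta_pow_char hz.pow_eq_one hπ α 1, eta_mul_self z hαα]
  obtain ⟨c, hc⟩ := exists_algebraMap_eq_of_pow_eq hfix
  refine ⟨(c.val : ℤ), ?_⟩
  have hcF : ((c.val : ℤ) : F) = eta α 1 z := by
    rw [Int.cast_natCast, ← map_natCast (algebraMap (ZMod p) F), ZMod.natCast_zmod_val, hc]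
  have key : (((schurPoly m α).eval (c.val : ℤ) : ℤ) : F) = 0 := by
    rw [← eq_intCast (Int.castRingHom F), ← eval₂_hom, ← eval_map, map_schurPoly hz, eval_prod]
    refine Finset.prod_eq_zero (Finset.mem_univ (1 : (ZMod m)ˣ)) ?_
    rw [eval_sub, eval_X, eval_C, eq_intCast, hcF, sub_self]
  rw [← ZMod.intCast_zmod_eq_zero_iff_dvd]
  apply (algebraMap (ZMod p) F).injective
  rw [map_intCast, map_zero]
  exact key

/-- **Murty–Thain's Theorem 4 (Schur) for `H = {1, α}`**: a prime divisor `p` of Schur's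
polynomial with `p ∤ m` and `p ∤ D` is `≡ 1` or `≡ α (mod m)` — a root `t mod p` is some
`η_k`, Frobenius fixes it, so `η_{πk} = η_kᵖ = η_k` with `π = p mod m`; as `p ∤ D` the generators
of different cosets stay distinct mod `p`, whence `πk ∈ {k, αk}`.
[cite: MurtyThain2006, §2 Theorem 4] -/
theorem cast_eq_one_or_eq_of_dvd_eval [NeZero m] {p : ℕ} (hp : p.Prime) (hpm : ¬ p ∣ m)
    {α : (ZMod m)ˣ} (hαα : α * α = 1) (hpD : ¬ (p : ℤ) ∣ dconst m (discGen α)) {t : ℤ}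
    (ht : (p : ℤ) ∣ (schurPoly m α).eval t) :
    (p : ZMod m) = 1 ∨ (p : ZMod m) = (α : ZMod m) := by
  haveI := Fact.mk hp
  have hcop : p.Coprime m := (Nat.Prime.coprime_iff_not_dvd hp).mpr hpm
  haveI : NeZero ((m : ℕ) : ZMod p) := ⟨by rw [Ne, ZMod.natCast_eq_zero_iff]; exact hpm⟩
  let F := CyclotomicField m (ZMod p)
  have hz : IsPrimitiveRoot (IsCyclotomicExtension.zeta m (ZMod p) F) m :=
    IsCyclotomicExtension.zeta_spec m (ZMod p) F
  set z := IsCyclotomicExtension.zeta m (ZMod p) F with hzdef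
  haveI : CharP F p := charP_of_injective_algebraMap (algebraMap (ZMod p) F).injective p
  set π : (ZMod m)ˣ := ZMod.unitOfCoprime p hcop with hπdef
  have hπ : ((p : ℕ) : ZMod m) = (π : ZMod m) := (ZMod.coe_unitOfCoprime p hcop).symm
  -- `t mod p` is one of the generators
  have key : (((schurPoly m α).eval t : ℤ) : F) = 0 := by
    have h0 : (((schurPoly m α).eval t : ℤ) : ZMod p) = 0 :=
      (ZMod.intCast_zmod_eq_zero_iff_dvd _ _).mpr ht
    rw [← map_intCast (algebraMap (ZMod p) F), h0, map_zero]
  rw [← eq_intCast (Int.castRingHom F), ← eval₂_hom, ← eval_map, map_schurPoly hz, eval_prod,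
    Finset.prod_eq_zero_iff] at key
  obtain ⟨k, -, hk⟩ := key
  rw [eval_sub, eval_X, eval_C, sub_eq_zero, eq_intCast] at hk
  -- Frobenius fixes it
  have hfix : eta α k z ^ p = eta α k z := by
    rw [← hk, ← map_intCast (algebraMap (ZMod p) F), ← map_pow, ZMod.pow_card]
  rw [eta_pow_char hz.pow_eq_one hπ α k] at hfix
  -- the discriminant does not vanish mod `p`
  have hD := aeval_eq_dconst (discGen α) (fun c => aeval_discGen_pow isPrimitiveRoot_zetaC.pow_eq_one α c) hz
  have hD0 : (dconst m (discGen α) : F) ≠ 0 := by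
    rw [← map_intCast (algebraMap (ZMod p) F), _root_.map_ne_zero, Ne,
      ZMod.intCast_zmod_eq_zero_iff_dvd]
    exact hpD
  rw [← hD, aeval_discGen, Finset.prod_ne_zero_iff] at hD0
  have hq := hD0 (π * k, k) (Finset.mem_univ _)
  by_contra hcontra
  push Not at hcontra
  rw [if_pos] at hq
  · exact hq (sub_eq_zero.mpr hfix)
  · refine ⟨fun h => hcontra.1 ?_, fun h => hcontra.2 ?_⟩
    · -- `k = π k` forces `π = 1`
      have h' : π * k = 1 * k := by rw [one_mul]; exact h.symm
      have hπ1 : π = 1 := mul_right_cancel h'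
      rw [hπ, hπ1, Units.val_one]
    · -- `k = α π k` forces `π = α⁻¹ = α`
      have h' : (α * π) * k = 1 * k := by rw [one_mul, mul_assoc]; exact h.symm
      have hαπ : α * π = 1 := mul_right_cancel h'
      have hπα : π = α := (eq_inv_of_mul_eq_one_right hαπ).trans (inv_eq_of_mul_eq_one_right hαα)
      rw [hπ, hπα]

/-! ### The unit `a mod m` and the main theorem -/

/-- The class of `a` as a unit of `ℤ/mℤ`, self-inverse because `a² ≡ 1 (mod m)`. [folklore] -/
def unitOfSqModEqOne {a : ℤ} (ha : a ^ 2 ≡ 1 [ZMOD m]) : (ZMod m)ˣ :=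
  have h : (a : ZMod m) * (a : ZMod m) = 1 := by
    have h2 := (ZMod.intCast_eq_intCast_iff (a ^ 2) 1 m).mpr ha
    push_cast at h2
    rw [← sq]; exact h2
  ⟨(a : ZMod m), (a : ZMod m), h, h⟩

/-- The unit `a mod m` squares to `1`. [folklore] -/
theorem unitOfSqModEqOne_mul_self {a : ℤ} (ha : a ^ 2 ≡ 1 [ZMOD m]) :
    unitOfSqModEqOne ha * unitOfSqModEqOne ha = 1 :=
  Units.ext (unitOfSqModEqOne ha).val_inv

/-- **Schur's theorem, explicit form (Murty–Thain, Theorems 4–6 with `u = −1`).** For `m ≥ 1` and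
`a² ≡ 1 (mod m)`, Schur's polynomial `f = ∏_{k ∈ (ℤ/mℤ)ˣ} (T − (1 + ζᵏ)(1 + ζᵃᵏ)) ∈ ℤ[T]` is an
`E`-polynomial for `a mod m`: it has degree `φ(m) > 0`; every prime `p ≡ a (mod m)` is a prime
divisor (Theorem 5), and there are infinitely many such primes (Dirichlet, Mathlib); every prime
divisor `p ∤ m · D` is `≡ 1` or `≡ a (mod m)` (Theorem 4).
[cite: MurtyThain2006, §2 Theorems 4–6 (pp. 252–254)] [cite: Schur1912] -/
theorem isEuclideanPolynomial_schurPoly [NeZero m] {a : ℤ} (ha : a ^ 2 ≡ 1 [ZMOD m]) :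
    IsEuclideanPolynomial (schurPoly m (unitOfSqModEqOne ha)) a m := by
  set α := unitOfSqModEqOne ha with hαdef
  have hαα : α * α = 1 := unitOfSqModEqOne_mul_self ha
  have hαa : (α : ZMod m) = (a : ZMod m) := rfl
  refine ⟨?_, ?_, ?_⟩
  · rw [natDegree_schurPoly, ZMod.card_units_eq_totient]
    exact Nat.totient_pos.mpr (NeZero.pos m)
  · -- clause (2): Theorem 5 + Dirichlet
    have hunit : IsUnit ((a : ℤ) : ZMod m) := ⟨α, hαa⟩
    have hDir := Nat.infinite_setOf_prime_and_eq_mod (q := m) (a := ((a : ℤ) : ZMod m)) hunit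
    refine hDir.mono ?_
    rintro p ⟨hp, hpa⟩
    have hpa' : (p : ℤ) ≡ a [ZMOD m] :=
      (ZMod.intCast_eq_intCast_iff _ _ _).mp (by simpa using hpa)
    have hunitp : IsUnit ((p : ℕ) : ZMod m) := by rw [hpa]; exact hunit
    have hcop : p.Coprime m := (ZMod.isUnit_iff_coprime p m).mp hunitp
    exact ⟨⟨hp, exists_dvd_eval_schurPoly hp hcop hαα (hpa.trans hαa.symm)⟩, hpa'⟩
  · -- clause (3): Theorem 4, exceptional primes `p ∣ m · D`
    set D := dconst m (discGen α) with hDdef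
    have hD0 : D ≠ 0 := dconst_discGen_ne_zero α
    have hN : 0 < m * D.natAbs := Nat.mul_pos (NeZero.pos m) (Int.natAbs_pos.mpr hD0)
    have hfinS : {p : ℕ | p ∣ m * D.natAbs}.Finite :=
      (Set.finite_Iic _).subset fun p hp => Nat.le_of_dvd hN hp
    refine hfinS.subset ?_
    rintro p ⟨⟨hp, t, ht⟩, hnot⟩
    by_contra hpS
    have hpm : ¬ p ∣ m := fun h => hpS (h.mul_right _)
    have hpD : ¬ (p : ℤ) ∣ D := fun h => hpS (Dvd.dvd.mul_left (Int.natCast_dvd.mp h) _)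
    rcases cast_eq_one_or_eq_of_dvd_eval hp hpm hαα hpD ht with h1 | h2
    · exact hnot (Or.inl ((ZMod.intCast_eq_intCast_iff _ _ _).mp (by simpa using h1)))
    · refine hnot (Or.inr ((ZMod.intCast_eq_intCast_iff _ _ _).mp ?_))
      rw [hαa] at h2
      simpa using h2

end Schur1912

/-- **Schur's existence theorem (1912), PROVED** — discharge of the named fact
`Schur1912_euclideanPolynomial` of `EuclideanProofs.lean`: if `m ≥ 1` and `a² ≡ 1 (mod m)`, an
`E`-polynomial for the progression `a mod m` exists, namely Schur's
`∏_{k ∈ (ℤ/mℤ)ˣ} (T − (1 + ζᵏ)(1 + ζᵃᵏ))` (`Schur1912.isEuclideanPolynomial_schurPoly`, following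
Murty–Thain's presentation of Schur's argument, Theorems 4–6, with the generator
`h(ζ) = (u − ζ)(u − ζᵃ)` at `u = −1` and Dirichlet's theorem for the infinitude clause).
[cite: Schur1912] [cite: MurtyThain2006, §2 Theorems 4–6 (pp. 252–254)] [cite: ConradEuclideanDirichlet, Theorem 1] -/
theorem Schur1912_euclideanPolynomial_holds : Schur1912_euclideanPolynomial := by
  intro m a hm ha
  haveI : NeZero m := ⟨hm.ne'⟩
  exact ⟨_, Schur1912.isEuclideanPolynomial_schurPoly ha⟩

end Literature.Barriers.Parity
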